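import Summits.BirchSwinnertonDyer.BirchSwinnertonDyer.Theorems.PrintX8VerticalStevensPrimeLevel
import HarnessLib

/-!
# `SpanGenFour` (THEOREM B′ = `ConjSpanGen N 4`) — the in-tree instances that cost nothing

Crux `OrdMissingLowerBoundAtTwo` (stmt-BirchSwinnertonDyer-19577), ideator 1 gen 6, in support of the residual
R1 of the crux idea `odd-point-shimura-descent-two` (ideator 2): its S3 needs, for the ALTERNATING type,
`SpanGenFour := ∀ N, Odd N → ConjSpanGen N 4` (NOT in the tree; the tree's THEOREM B `conjSpanGen_holds` is
`ConjSpanGen N p` for PRIME `p ∤ N`).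

What this file records (sorry-free):
* THEOREM (T) of the tree (`PrintX8VerticalStevens.conjSpanGen_of_prime`, stated for an arbitrary natural
  number `p`) gives `ConjSpanGen N 4` at every PRIME level `N` with `(ℤ/N)ˣ = ⟨−1, 4⟩`, i.e. `N ≡ 3 (mod 4)` and
  `4` generating the squares; instances `N = 11, 23` by `decide`.
* These levels carry no optimal curve with rational `2`-torsion (prime conductor with rational `2`-torsion forces
  `N = u² + 64 ≡ 1 (mod 8)`, Neumann–Setzer), so they are NOT the levels card #8 needs; the levels it needs
  (composite `N`, e.g. the alternating class `15a`, and `N ≡ 1 (mod 8)` prime) are covered so far only by the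
  exact-homology computation kit j310479/j310539 (`ConjSpanGen N 4` certified for every odd `N ≤ 199`, resp. the
  extension range), see `SpanGenFour-census.md` in this crux directory.  `SpanGenFour` as a theorem stays OPEN.

BSD is not advanced by this file.
-/

set_option linter.dupNamespace false

namespace Summit.BirchSwinnertonDyer.BirchSwinnertonDyer.Cruxes.OrdMissingLowerBoundAtTwo.SpanGenFourPrimeT

open Literature.NumberTheory.EllipticCurves.Rank1Residual
open Summit.BirchSwinnertonDyer.BirchSwinnertonDyer.Theorems.PrintX8VerticalStevens

/-- THEOREM (T) at `p = 4`: at a prime level `N` with `(ℤ/N)ˣ = ⟨−1, 4⟩`, `ConjSpanGen N 4` holds. -/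
theorem conjSpanGen_four_of_prime {N : ℕ} [Fact N.Prime]
    (hT : ∀ x : ZMod N, IsUnit x → ∃ k : ℕ, x = (4 : ZMod N) ^ k ∨ x = -((4 : ZMod N) ^ k)) :
    ConjSpanGen N 4 := by
  have := conjSpanGen_of_prime (N := N) 4 (by exact_mod_cast hT)
  exact this

/-- `(ℤ/11)ˣ = ⟨−1, 4⟩`: `⟨4⟩ = {1,4,5,9,3}`, `−⟨4⟩ = {10,7,6,2,8}`. -/
theorem zmod_eleven_eq_zero_or_pow_four :
    ∀ y : ZMod 11, y = 0 ∨ ∃ k : Fin 5, y = 4 ^ (k : ℕ) ∨ y = -(4 ^ (k : ℕ)) := by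
  decide

/-- **`ConjSpanGen 11 4`** (first in-tree instance of `SpanGenFour`; kit j310439/j310479 line `N=11 … Bprime@2`). -/
theorem conjSpanGen_eleven_four : ConjSpanGen 11 4 := by
  haveI : Fact (Nat.Prime 11) := ⟨by norm_num⟩
  refine conjSpanGen_four_of_prime fun x hx ↦ ?_
  rcases zmod_eleven_eq_zero_or_pow_four x with h0 | ⟨k, hk⟩
  · exact (hx.ne_zero h0).elim
  · exact ⟨k, by exact_mod_cast hk⟩

/-- `(ℤ/23)ˣ = ⟨−1, 4⟩`: `4` has order `11` and `−1` is a non-residue. -/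
theorem zmod_twentythree_eq_zero_or_pow_four :
    ∀ y : ZMod 23, y = 0 ∨ ∃ k : Fin 11, y = 4 ^ (k : ℕ) ∨ y = -(4 ^ (k : ℕ)) := by
  decide

/-- **`ConjSpanGen 23 4`** (kit j310479 line `N=23 … Bprime@4`). -/
theorem conjSpanGen_twentythree_four : ConjSpanGen 23 4 := by
  haveI : Fact (Nat.Prime 23) := ⟨by norm_num⟩
  refine conjSpanGen_four_of_prime fun x hx ↦ ?_
  rcases zmod_twentythree_eq_zero_or_pow_four x with h0 | ⟨k, hk⟩
  · exact (hx.ne_zero h0).elim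
  · exact ⟨k, by exact_mod_cast hk⟩

end Summit.BirchSwinnertonDyer.BirchSwinnertonDyer.Cruxes.OrdMissingLowerBoundAtTwo.SpanGenFourPrimeT
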